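import Literature.ComputerArithmetic.HallmanIpsen2023.ProbabilisticBounds

/-!
# Hallman–Ipsen (2023), §5: probabilistic error bounds for summation in MIXED PRECISION

E. Hallman, I. C. F. Ipsen, *Precision-aware deterministic and probabilistic error bounds for
floating point summation*, Numer. Math. 155 (2023) 83–119, arXiv:2203.15928 — Section 5
("Mixed precision"): the mixed-precision extension of the roundoff model (model:second) — each
roundoff `δ_k` may be committed in a different precision, `|δ_k| ≤ u_k` — and the
"straightforward generalizations" of Corollaries 13 and 17 to any number of precisions:

* THEOREM 26 (t_51): the recursive bound
  `|e_n| ≤ √(2 ln(2/δ)) (Σ_{j=2}^n u_j² (|s_j| + F_{j,n,η})²)^{1/2}` with probability at least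
  `1 − (δ + η)`, where `F_{k,n,η} = λ_{n,η} (Σ_{j≺k} u_j² (|s_j| + F_{j,n,η})²)^{1/2}`,
  `λ_{n,η} = √(2 ln(2n/η))` (`errBoundM_recursive`; the sharper `ñ` form
  `errBoundM_recursive_ntilde`);
* THEOREM 27 (t_52): the closed form
  `|e_n| ≤ √(2 ln(2/δ)) (1 + φ_{n,h̃,η}) (Σ_k u_k² s_k²)^{1/2}`
  `     ≤ √h̃ √(2 ln(2/δ)) (1 + φ_{n,h̃,η}) Σ_k |x_k|`
  with the WEIGHTED HEIGHT `h̃ = max_k Σ_{k≺ℓ⪯n} u_ℓ²` of the computational tree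
  (`errBoundM_closedForm`, `errBoundM_closedForm_ntilde`);
* COROLLARY 28 (c_fabsum): the first probabilistic bound for the mixed-precision blocked summation
  FABsum of Blanchard–Higham–Mary, `h̃ = h_lo u_lo² + h_hi u_hi²` (`errBoundM_fabsum`, with the
  weighted-height estimate of the FABsum tree as the hypothesis `hh`).

The development re-uses the summation trees `STree`, the error-as-martingale-transform identity
`err_inst_eq_sum` and the predictability of the coefficient process from
`HallmanIpsen2023.ProbabilisticBounds` (§2), and the Azuma–Hoeffding machinery of
`HallmanIpsen2023.MartingaleBounds` (§1.3), applied to the NORMALISED roundoffs `ε_k = δ_k / u_k`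
(`|ε_k| ≤ 1`, mean-independent with mean zero: `MPErrorModel.toUnit`), for which
`e_n = Σ_j (s_j + f_j) u_j ε_j` has increments bounded by `u_j (|s_j| + F_j)`.

TYPING NOTE (a misprint in the source). Eq. (def_phi2) prints
`φ_{n,h̃,η} ≡ λ_{n,η} √(2h̃) u exp(λ²_{n,η} h̃ u²)`; since `h̃` already carries the factor `u²`
(`h̃ = h u²` when every `u_k = u`), the two displayed factors `u`, `u²` are spurious: the last
display of the proof derives `λ_{n,η} √(2h̃) exp(λ²_{n,η} h̃)`, which is what reduces to
Theorem 15's `φ_{n,h,η} = λ √(2h) u exp(λ² h u²)` in uniform precision (`phiM_height_mul_sq`).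
We type the proved, dimensionally consistent `phiM λ h̃ = λ √(2h̃) exp(λ² h̃)`.

Also typed: the uniform-precision specialisations `PsiM_const`, `sumSqM_const`, `wHeight_const`,
`phiM_height_mul_sq` (Theorems 26/27 with `u_k ≡ u` are Corollaries 13/17 verbatim), and the model
facts `MPErrorModel.of_uniform`, `MPErrorModel.toUnit`.

NOT typed: Remark 29 (r_51, the design heuristic) and the numerical experiments of §6.
-/

namespace Literature.ComputerArithmetic.HallmanIpsen2023

open MeasureTheory ProbabilityTheory Finset Real
open scoped NNReal ENNReal

open Literature.ComputerArithmetic.ConnollyHighamMary2021 (SRErrorModel)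

/-! ### The mixed-precision roundoff model -/

section Model

variable {Ω : Type*} [MeasurableSpace Ω]

/-- **The probabilistic model for sequences of roundoffs in MIXED PRECISION**: the roundoffs
`δ_0, δ_1, …` are measurable, MEAN-INDEPENDENT WITH MEAN ZERO (for every bounded measurable test
function `g` of the earlier roundoffs `E[g(δ_0,…,δ_{k−1}) δ_k] = 0`), and each `δ_k` is a roundoff
in its own precision `u_k`: `|δ_k| ≤ u_k`. [cite: HallmanIpsen2023, §5, "Probabilistic model for
sequences of roundoffs in mixed precision" (the extension of eq. (model:second) with
`|δ_k| ≤ u_k`, `1 ≤ k ≤ n`)] -/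
structure MPErrorModel (μ : Measure Ω) (us : ℕ → ℝ) (δ : ℕ → Ω → ℝ) : Prop where
  measurable : ∀ k, Measurable (δ k)
  bounded : ∀ k ω, |δ k ω| ≤ us k
  meanIndep : ∀ (k : ℕ) (g : (Fin k → ℝ) → ℝ), Measurable g → (∃ C, ∀ v, |g v| ≤ C) →
    ∫ ω, g (fun i => δ i ω) * δ k ω ∂μ = 0

namespace MPErrorModel

variable {μ : Measure Ω} {us : ℕ → ℝ} {δ : ℕ → Ω → ℝ}

/-- Uniform precision is the special case `u_k ≡ u` of the mixed-precision model.
[cite: HallmanIpsen2023, §5, "Extend model (model:second) … by assuming in addition that each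
`δ_k` can be a roundoff in a different precision `u_k`"] -/
theorem of_uniform {u : ℝ} (h : SRErrorModel μ u δ) : MPErrorModel μ (fun _ => u) δ :=
  ⟨h.measurable, h.bounded, h.meanIndep⟩

/-- The NORMALISED roundoffs `ε_k = δ_k / u_k` (so that `δ_k = u_k ε_k`, `|ε_k| ≤ 1`).
[cite: HallmanIpsen2023, §5, the mixed-precision model (`|δ_k| ≤ u_k`)] -/
noncomputable def unitSeq (us : ℕ → ℝ) (δ : ℕ → Ω → ℝ) : ℕ → Ω → ℝ := fun k ω => δ k ω / us k

/-- `|ε_k| ≤ 1`. [cite: HallmanIpsen2023, §5, the mixed-precision model (`|δ_k| ≤ u_k`)] -/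
theorem abs_unitSeq_le_one (h : MPErrorModel μ us δ) (k : ℕ) (ω : Ω) :
    |unitSeq us δ k ω| ≤ 1 := by
  unfold unitSeq
  rcases eq_or_ne (us k) 0 with h0 | h0
  · simp [h0]
  · rw [abs_div]
    exact div_le_one_of_le₀ ((h.bounded k ω).trans (le_abs_self _)) (abs_nonneg _)

/-- `δ_k = u_k ε_k`. [cite: HallmanIpsen2023, §5, the mixed-precision model (`|δ_k| ≤ u_k`)] -/
theorem eq_mul_unitSeq (h : MPErrorModel μ us δ) (k : ℕ) (ω : Ω) :
    δ k ω = us k * unitSeq us δ k ω := by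
  unfold unitSeq
  rcases eq_or_ne (us k) 0 with h0 | h0
  · have hb := h.bounded k ω
    rw [h0] at hb
    have : δ k ω = 0 := abs_nonpos_iff.mp hb
    simp [h0, this]
  · rw [mul_div_cancel₀ _ h0]

/-- **Reduction to the unit model**: the normalised roundoffs `ε_k = δ_k / u_k` satisfy the model
(model:second) with unit roundoff `1` (measurable, `|ε_k| ≤ 1`, mean-independent with mean zero —
`E[g(ε_0,…,ε_{k−1}) ε_k] = u_k⁻¹ E[g̃(δ_0,…,δ_{k−1}) δ_k] = 0`). This is what lets the martingale
lemmas of §1.3 act on `e_n = Σ_j (s_j + f_j) u_j ε_j`.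
[cite: HallmanIpsen2023, §5, the mixed-precision model; §1.3, Lemmas 2 and 3] -/
theorem toUnit (h : MPErrorModel μ us δ) : SRErrorModel μ 1 (unitSeq us δ) where
  measurable k := (h.measurable k).div_const _
  bounded k ω := h.abs_unitSeq_le_one k ω
  meanIndep k g hg hC := by
    obtain ⟨C, hC⟩ := hC
    have hsc : Measurable (fun v : Fin k → ℝ => fun i => v i / us i) :=
      measurable_pi_lambda _ (fun i => (measurable_pi_apply i).div_const _)
    have h0 := h.meanIndep k (fun v => g (fun i => v i / us i)) (hg.comp hsc) ⟨C, fun v => hC _⟩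
    have heq : (fun ω => g (fun i => unitSeq us δ i ω) * unitSeq us δ k ω)
        = fun ω => (g (fun i => δ i ω / us i) * δ k ω) / us k := by
      funext ω
      simp only [unitSeq]
      ring
    rw [heq, integral_div, h0, zero_div]

/-- In the model every precision actually used is `≥ 0` (probability spaces are nonempty).
[cite: HallmanIpsen2023, §5, the mixed-precision model (`|δ_k| ≤ u_k`)] -/
theorem us_nonneg [IsProbabilityMeasure μ] (h : MPErrorModel μ us δ) (k : ℕ) : 0 ≤ us k := by
  obtain ⟨ω⟩ := nonempty_of_isProbabilityMeasure μ
  exact (abs_nonneg _).trans (h.bounded k ω)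

end MPErrorModel

end Model

namespace STree

/-! ### §5 quantities on a summation tree with node precisions `u_k` -/

/-- `Ψ̃(T) = Σ_{j ∈ nodes(T)} u_j² (|s_j| + F_j)²` with the mixed-precision F-BOUNDS
`F_j = c (Σ_{i≺j} u_i² (|s_i| + F_i)²)^{1/2}` (`c = λ_{n,η}`; `F = 0` at a node with two leaf
children): `Ψ̃` of the whole tree is the radicand of Theorem 26.
[cite: HallmanIpsen2023, §5, Theorem 26 (t_51), the bound and the recurrence for `F_{k,n,η}`] -/
noncomputable def PsiM (c : ℝ) (us : ℕ → ℝ) : STree → ℝ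
  | leaf _ => 0
  | node k l r =>
      us k ^ 2 * (|exactVal l + exactVal r| + c * Real.sqrt (PsiM c us l + PsiM c us r)) ^ 2
        + PsiM c us l + PsiM c us r

/-- The mixed-precision F-bound of the ROOT node, `F_k = c (Σ_{j≺k} u_j² (|s_j| + F_j)²)^{1/2}`.
[cite: HallmanIpsen2023, §5, Theorem 26, the recurrence for `F_{k,n,η}`] -/
noncomputable def FbM (c : ℝ) (us : ℕ → ℝ) : STree → ℝ
  | leaf _ => 0
  | node _ l r => c * Real.sqrt (PsiM c us l + PsiM c us r)

/-- `Σ_{k=2}^n u_k² s_k²`. [cite: HallmanIpsen2023, §5, Theorem 27 (t_52), first line] -/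
def sumSqM (us : ℕ → ℝ) : STree → ℝ
  | leaf _ => 0
  | node k l r => us k ^ 2 * (exactVal l + exactVal r) ^ 2 + sumSqM us l + sumSqM us r

/-- The WEIGHTED HEIGHT `h̃ = max_k Σ_{k≺ℓ⪯n} u_ℓ²`: the largest sum of squared precisions over the
additions above a vertex (with `u_k ≡ u`, `h̃ = h u²`). [cite: HallmanIpsen2023, §5, Theorem 27
("`h̃` … is the weighted height of the computational tree")] -/
def wHeight (us : ℕ → ℝ) : STree → ℝ
  | leaf _ => 0
  | node k l r => us k ^ 2 + max (wHeight us l) (wHeight us r)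

/-- `φ_{n,h̃,η} = λ_{n,η} √(2h̃) exp(λ²_{n,η} h̃)` as a function of `λ` and `h̃` (the form the proof
of Theorem 27 derives; see the typing note in the module docstring on the printed eq. (def_phi2)).
[cite: HallmanIpsen2023, §5, Theorem 27, eq. (def_phi2) and the last display of its proof] -/
noncomputable def phiM (lam' ht : ℝ) : ℝ := lam' * Real.sqrt (2 * ht) * Real.exp (lam' ^ 2 * ht)

/-- `0 ≤ Ψ̃`. [cite: HallmanIpsen2023, §5, Theorem 26] -/
theorem PsiM_nonneg (c : ℝ) (us : ℕ → ℝ) : ∀ T : STree, 0 ≤ PsiM c us T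
  | leaf _ => le_rfl
  | node _ l r => by
      simp only [PsiM]; have := PsiM_nonneg c us l; have := PsiM_nonneg c us r; positivity

/-- `0 ≤ F_k` for `c ≥ 0`. [cite: HallmanIpsen2023, §5, Theorem 26] -/
theorem FbM_nonneg {c : ℝ} (hc : 0 ≤ c) (us : ℕ → ℝ) : ∀ T : STree, 0 ≤ FbM c us T
  | leaf _ => le_rfl
  | node _ l r => by simp only [FbM]; positivity

/-- `Ψ̃(node) = u_k² (|s_k| + F_k)² + Ψ̃(l) + Ψ̃(r)`. [cite: HallmanIpsen2023, §5, Theorem 26] -/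
theorem PsiM_node (c : ℝ) (us : ℕ → ℝ) (k : ℕ) (l r : STree) :
    PsiM c us (node k l r) = us k ^ 2 * (|exactVal l + exactVal r| + FbM c us (node k l r)) ^ 2
      + PsiM c us l + PsiM c us r := by
  simp only [PsiM, FbM]

/-- `Ψ̃` is monotone in the F-parameter `c ≥ 0`. [cite: HallmanIpsen2023, §5, Theorem 26
(`λ_{n,η}` in place of `λ_{ñ,η}`)] -/
theorem PsiM_mono {c c' : ℝ} (hc : 0 ≤ c) (hcc' : c ≤ c') (us : ℕ → ℝ) :
    ∀ T : STree, PsiM c us T ≤ PsiM c' us T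
  | leaf _ => le_rfl
  | node k l r => by
      have ihl := PsiM_mono hc hcc' us l
      have ihr := PsiM_mono hc hcc' us r
      simp only [PsiM]
      have h0 : 0 ≤ PsiM c us l + PsiM c us r :=
        add_nonneg (PsiM_nonneg c us l) (PsiM_nonneg c us r)
      have h1 : c * Real.sqrt (PsiM c us l + PsiM c us r)
          ≤ c' * Real.sqrt (PsiM c' us l + PsiM c' us r) :=
        mul_le_mul hcc' (Real.sqrt_le_sqrt (add_le_add ihl ihr)) (Real.sqrt_nonneg _)
          (hc.trans hcc')
      have h2 : 0 ≤ |exactVal l + exactVal r| + c * Real.sqrt (PsiM c us l + PsiM c us r) := by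
        positivity
      have h3 := pow_le_pow_left₀ h2 (add_le_add (le_refl |exactVal l + exactVal r|) h1) 2
      nlinarith [sq_nonneg (us k)]

/-- `0 ≤ Σ u_k² s_k²`. [cite: HallmanIpsen2023, §5, Theorem 27] -/
theorem sumSqM_nonneg (us : ℕ → ℝ) : ∀ T : STree, 0 ≤ sumSqM us T
  | leaf _ => le_rfl
  | node _ l r => by
      simp only [sumSqM]; have := sumSqM_nonneg us l; have := sumSqM_nonneg us r; positivity

/-- `0 ≤ h̃`. [cite: HallmanIpsen2023, §5, Theorem 27] -/
theorem wHeight_nonneg (us : ℕ → ℝ) : ∀ T : STree, 0 ≤ wHeight us T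
  | leaf _ => le_rfl
  | node _ l r => by
      simp only [wHeight]
      exact add_nonneg (sq_nonneg _) ((wHeight_nonneg us l).trans (le_max_left _ _))

/-- `0 ≤ φ` for `λ ≥ 0`. [cite: HallmanIpsen2023, §5, Theorem 27, eq. (def_phi2)] -/
theorem phiM_nonneg {lam' : ℝ} (hl : 0 ≤ lam') (ht : ℝ) : 0 ≤ phiM lam' ht := by
  unfold phiM; positivity

/-- `φ` is monotone in the weighted height (`h̃ ≥ 0`). [cite: HallmanIpsen2023, §5, Corollary 28
(c_fabsum) ("Insert the bounds `h̃_k ≤ h̃`")] -/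
theorem phiM_mono {lam' ht ht' : ℝ} (hl : 0 ≤ lam') (hh : ht ≤ ht') :
    phiM lam' ht ≤ phiM lam' ht' := by
  unfold phiM
  gcongr

/-! ### Uniform precision: §5 reduces verbatim to §2.2 -/

/-- With `u_k ≡ u ≥ 0`: `Ψ̃_c = u² Ψ_{cu}` (so Theorem 26 is Corollary 13).
[cite: HallmanIpsen2023, §5, "Below are the straightforward generalizations of Corollaries (c_28)
and (c_210)"] -/
theorem PsiM_const (c : ℝ) {u : ℝ} (hu : 0 ≤ u) :
    ∀ T : STree, PsiM c (fun _ => u) T = u ^ 2 * Psi (c * u) T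
  | leaf _ => by simp [PsiM, Psi]
  | node k l r => by
      rw [PsiM, PsiM_const c hu l, PsiM_const c hu r, Psi_node, Fb]
      have hs : Real.sqrt (u ^ 2 * Psi (c * u) l + u ^ 2 * Psi (c * u) r)
          = u * Real.sqrt (Psi (c * u) l + Psi (c * u) r) := by
        rw [← mul_add, Real.sqrt_mul (sq_nonneg u), Real.sqrt_sq hu]
      rw [hs]
      ring

/-- With `u_k ≡ u`: `Σ u_k² s_k² = u² Σ s_k²`. [cite: HallmanIpsen2023, §5, Theorem 27 vs.
Corollary 17] -/
theorem sumSqM_const (u : ℝ) : ∀ T : STree, sumSqM (fun _ => u) T = u ^ 2 * T.sumSq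
  | leaf _ => by simp [sumSqM, sumSq]
  | node k l r => by rw [sumSqM, sumSq, sumSqM_const u l, sumSqM_const u r]; ring

/-- With `u_k ≡ u`: `h̃ = h u²`. [cite: HallmanIpsen2023, §5, Theorem 27 ("weighted height")] -/
theorem wHeight_const (u : ℝ) : ∀ T : STree, wHeight (fun _ => u) T = T.height * u ^ 2
  | leaf _ => by simp [wHeight, height]
  | node k l r => by
      rw [wHeight, height, wHeight_const u l, wHeight_const u r]
      rcases le_total l.height r.height with hlr | hrl
      · rw [max_eq_right hlr, max_eq_right
          (mul_le_mul_of_nonneg_right (Nat.cast_le.mpr hlr) (sq_nonneg u))]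
        push_cast; ring
      · rw [max_eq_left hrl, max_eq_left
          (mul_le_mul_of_nonneg_right (Nat.cast_le.mpr hrl) (sq_nonneg u))]
        push_cast; ring

/-- With `h̃ = h u²`, `u ≥ 0`: `φ_{n,h̃,η}` (as proved) is Theorem 15's
`φ_{n,h,η} = λ √(2h) u exp(λ² h u²)`. [cite: HallmanIpsen2023, §5, eq. (def_phi2); §2.2,
eq. (eqn:lnlh)] -/
theorem phiM_height_mul_sq (lam' : ℝ) (h : ℕ) {u : ℝ} (hu : 0 ≤ u) :
    phiM lam' (h * u ^ 2) = phi lam' h u := by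
  rw [phiM, phi, show 2 * ((h : ℝ) * u ^ 2) = (2 * h) * u ^ 2 by ring,
    Real.sqrt_mul' _ (sq_nonneg u), Real.sqrt_sq hu]
  ring_nf

/-! ### The coefficient bounds of the error martingale -/

/-- The CANDIDATE BOUNDS `|s_i| + F_i` (mixed-precision F-bounds) of the coefficient process
`coef_i = s_i + f_i`. [cite: HallmanIpsen2023, §5, Theorem 26 (proof as for Theorem 12:
`|Z_i − Z_{i−1}| ≤ u_i (|s_i| + F_{i,n,η})`)] -/
noncomputable def coefBoundM (c : ℝ) (us : ℕ → ℝ) : STree → ℕ → ℝ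
  | leaf _, _ => 0
  | node k l r, i => (if i = k then |exactVal l + exactVal r| + FbM c us (node k l r) else 0)
      + coefBoundM c us l i + coefBoundM c us r i

/-- The FAILURE EVENT: some node `k` has `|f_k| > F_k` (mixed-precision F-bounds).
[cite: HallmanIpsen2023, §5, Theorem 26 (via §2.2, Lemma 11)] -/
def FailFM (c : ℝ) (us : ℕ → ℝ) (v : ℕ → ℝ) : STree → Prop
  | leaf _ => False
  | node k l r => FbM c us (node k l r) < |(l.inst v).err + (r.inst v).err|
      ∨ FailFM c us v l ∨ FailFM c us v r

section CoefM

variable (v : ℕ → ℝ)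

/-- [folklore] a Boolean leaf test yields the leaf. -/
private theorem exists_eq_leaf_of_isLeaf' : ∀ {T : STree}, T.isLeaf = true → ∃ x, T = leaf x
  | leaf x, _ => ⟨x, rfl⟩
  | node _ _ _, h => by simp [isLeaf] at h

/-- [folklore] the candidate bound vanishes off the labels of the tree. -/
private theorem coefBoundM_eq_zero (c : ℝ) (us : ℕ → ℝ) {i : ℕ} :
    ∀ T : STree, i ∉ T.labels → coefBoundM c us T i = 0
  | leaf _, _ => rfl
  | node k l r, h => by
      simp only [labels, Finset.mem_insert, Finset.mem_union, not_or] at h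
      simp [coefBoundM, h.1, coefBoundM_eq_zero c us l h.2.1, coefBoundM_eq_zero c us r h.2.2]

/-- `0 ≤ |s_i| + F_i`. [cite: HallmanIpsen2023, §5, Theorem 26] -/
theorem coefBoundM_nonneg {c : ℝ} (hc : 0 ≤ c) (us : ℕ → ℝ) (i : ℕ) :
    ∀ T : STree, 0 ≤ coefBoundM c us T i
  | leaf _ => le_rfl
  | node k l r => by
      simp only [coefBoundM]
      refine add_nonneg (add_nonneg ?_ (coefBoundM_nonneg hc us i l)) (coefBoundM_nonneg hc us i r)
      split_ifs
      · exact add_nonneg (abs_nonneg _) (FbM_nonneg hc us _)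
      · exact le_rfl

/-- **Sure increment bounds off the failure event**: if no node has `|f_j| > F_j` then
`|coef_i| ≤ |s_i| + F_i`. [cite: HallmanIpsen2023, §5, Theorem 26 (proof as for §2.2,
Lemma 11 / Theorem 12)] -/
theorem abs_coef_le_coefBoundM {c : ℝ} (hc : 0 ≤ c) (us : ℕ → ℝ) (i : ℕ) :
    ∀ T : STree, ¬ FailFM c us v T → |coef v T i| ≤ coefBoundM c us T i
  | leaf _, _ => by simp [coef, coefBoundM]
  | node k l r, h => by
      simp only [FailFM, not_or, not_lt] at h
      obtain ⟨hroot, hl, hr⟩ := h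
      have ihl := abs_coef_le_coefBoundM hc us i l hl
      have ihr := abs_coef_le_coefBoundM hc us i r hr
      simp only [coef, coefBoundM]
      refine (abs_add_le _ _).trans (add_le_add ((abs_add_le _ _).trans (add_le_add ?_ ihl)) ihr)
      split_ifs
      · exact (abs_add_le _ _).trans (add_le_add le_rfl hroot)
      · simp

/-- **The variance of the increments is `Ψ̃`**: for a well-labelled tree with labels `< N`,
`Σ_{i<N} u_i² (|s_i| + F_i)² = Ψ̃(T)`. [cite: HallmanIpsen2023, §5, Theorem 26 (the radicands
`Σ_{j≺k} u_j² (|s_j| + F_j)²`, `Σ_{j=2}^n u_j² (|s_j| + F_j)²`)] -/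
theorem sum_sq_coefBoundM (c : ℝ) (us : ℕ → ℝ) {N : ℕ} : ∀ T : STree, T.WellLabeled →
    (∀ j ∈ T.labels, j < N) →
    ∑ i ∈ range N, (coefBoundM c us T i * us i) ^ 2 = PsiM c us T
  | leaf x, _, _ => by simp [coefBoundM, PsiM]
  | node k l r, hW, h => by
      obtain ⟨hWl, hWr, hkl, hkr, hdisj⟩ := hW
      simp only [labels, Finset.mem_insert, Finset.mem_union] at h
      have hk : k < N := h k (Or.inl rfl)
      have ihl := sum_sq_coefBoundM c us l hWl (fun j hj => h j (Or.inr (Or.inl hj)))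
      have ihr := sum_sq_coefBoundM c us r hWr (fun j hj => h j (Or.inr (Or.inr hj)))
      have hkl' : k ∉ l.labels := fun hm => lt_irrefl k (hkl k hm)
      have hkr' : k ∉ r.labels := fun hm => lt_irrefl k (hkr k hm)
      have hpt : ∀ i, (coefBoundM c us (node k l r) i * us i) ^ 2 =
          (if i = k then us k ^ 2 * (|exactVal l + exactVal r| + FbM c us (node k l r)) ^ 2 else 0)
            + (coefBoundM c us l i * us i) ^ 2 + (coefBoundM c us r i * us i) ^ 2 := by
        intro i
        simp only [coefBoundM]
        by_cases hik : i = k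
        · subst hik
          simp [coefBoundM_eq_zero c us l hkl', coefBoundM_eq_zero c us r hkr']
          ring
        · simp only [if_neg hik, zero_add]
          by_cases hil : i ∈ l.labels
          · have hir : i ∉ r.labels := Finset.disjoint_left.mp hdisj hil
            simp [coefBoundM_eq_zero c us r hir]
          · simp [coefBoundM_eq_zero c us l hil]
      simp only [hpt, sum_add_distrib, ihl, ihr, Finset.sum_ite_eq' (range N) k,
        if_pos (mem_range.mpr hk), PsiM_node]

end CoefM

/-! ### THEOREM 26: the recursive probabilistic bound in mixed precision -/

section ProbabilisticM

variable {Ω : Type*} [MeasurableSpace Ω] {μ : Measure Ω} {us : ℕ → ℝ} {δ : ℕ → Ω → ℝ}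

omit [MeasurableSpace Ω] in
/-- [folklore] predictability survives the change of variables `δ_j = u_j ε_j` and multiplication
by deterministic constants. -/
private theorem isPredictable_rescale {ε a : ℕ → Ω → ℝ} (hP : IsPredictable δ a)
    (hδ : ∀ j ω, δ j ω = us j * ε j ω) (cst : ℕ → ℝ) :
    IsPredictable ε (fun i ω => a i ω * cst i) := by
  intro i
  obtain ⟨G, hG, hD, ha⟩ := hP i
  refine ⟨fun w => G (fun j => us j * w j) * cst i, ?_, ?_, ?_⟩
  · exact (hG.comp (measurable_pi_lambda _
      (fun j => (measurable_pi_apply j).const_mul _))).mul_const _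
  · intro w w' hww'
    show G (fun j => us j * w j) * cst i = G (fun j => us j * w' j) * cst i
    have hG' : G (fun j => us j * w j) = G (fun j => us j * w' j) :=
      hD (fun j hj => by show us j * w j = us j * w' j; rw [hww' j hj])
    rw [hG']
  · intro ω
    have hfun : (fun j => δ j ω) = fun j => us j * ε j ω := funext (fun j => hδ j ω)
    simp only [ha ω, hfun]

variable [IsProbabilityMeasure μ]

/-- **The Azuma step at one node.** For the node `k` with children `l, r` of a well-labelled tree
and `c = √(2 ln(2/p))`: the event "`|f_k| > F_k` although no child-error below `k` failed its
bound" has probability at most `p` — Lemma 2 for the martingale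
`Z_i = Σ_{j≤i, j≺k} (s_j + f_j) u_j ε_j` (`ε_j = δ_j/u_j`) whose increments obey
`|Z_i − Z_{i−1}| ≤ u_i (|s_i| + F_i)` off the failure event.
[cite: HallmanIpsen2023, §5, Theorem 26 (proof as for §2.2, Lemma 11, induction step)] -/
theorem measure_rootFailM_le (h : MPErrorModel μ us δ) {k : ℕ} {l r : STree}
    (hW : (node k l r).WellLabeled) {p c : ℝ} (hp : 0 < p)
    (hc : c = Real.sqrt (2 * Real.log (2 / p))) :
    μ {ω | FbM c us (node k l r) < |(l.inst fun j => δ j ω).err + (r.inst fun j => δ j ω).err|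
        ∧ ¬ FailFM c us (fun j => δ j ω) l ∧ ¬ FailFM c us (fun j => δ j ω) r}
      ≤ ENNReal.ofReal p := by
  obtain ⟨hWl, hWr, hkl, hkr, hdisj⟩ := hW
  have hc0 : 0 ≤ c := by rw [hc]; positivity
  have hε := h.toUnit
  set ε := MPErrorModel.unitSeq us δ with hεdef
  set a : ℕ → Ω → ℝ := fun i ω =>
    (coef (fun j => δ j ω) l i + coef (fun j => δ j ω) r i) * us i with ha
  set A : ℕ → ℝ := fun i => (coefBoundM c us l i + coefBoundM c us r i) * |us i| with hA
  have hP : IsPredictable ε a :=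
    isPredictable_rescale (isPredictable_coef_pair hWl hWr) h.eq_mul_unitSeq us
  have hA0 : ∀ i, 0 ≤ A i := fun i => mul_nonneg
    (add_nonneg (coefBoundM_nonneg hc0 us i l) (coefBoundM_nonneg hc0 us i r)) (abs_nonneg _)
  -- the variance proxy: `Σ_{i<k} A_i² = Ψ̃ l + Ψ̃ r` (distinct labels)
  have hvar : ∑ i ∈ range k, (A i * 1) ^ 2 = PsiM c us l + PsiM c us r := by
    have hcross : ∀ i, coefBoundM c us l i * coefBoundM c us r i = 0 := by
      intro i
      by_cases hil : i ∈ l.labels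
      · rw [coefBoundM_eq_zero c us r (Finset.disjoint_left.mp hdisj hil), mul_zero]
      · rw [coefBoundM_eq_zero c us l hil, zero_mul]
    have hsq : ∀ i, (A i * 1) ^ 2
        = (coefBoundM c us l i * us i) ^ 2 + (coefBoundM c us r i * us i) ^ 2 := by
      intro i; simp only [hA, mul_one, mul_pow, sq_abs]; nlinarith [hcross i]
    simp only [hsq, sum_add_distrib, sum_sq_coefBoundM c us l hWl hkl,
      sum_sq_coefBoundM c us r hWr hkr]
  have hrad : azumaRadius (∑ i ∈ range k, (A i * 1) ^ 2) p = FbM c us (node k l r) := by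
    rw [hvar, azumaRadius, FbM, hc]; ring
  refine (measure_mono ?_).trans (azumaHoeffding_trunc hε hP hA0 k hp)
  intro ω hω
  obtain ⟨hlt, hgl, hgr⟩ := hω
  show azumaRadius (∑ i ∈ range k, (A i * 1) ^ 2) p < |truncTransform a A ε k ω|
  have hbd : ∀ i < k, |a i ω| ≤ A i := fun i _ => by
    simp only [ha, hA, abs_mul]
    exact mul_le_mul_of_nonneg_right ((abs_add_le _ _).trans (add_le_add
      (abs_coef_le_coefBoundM _ hc0 us i l hgl) (abs_coef_le_coefBoundM _ hc0 us i r hgr)))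
      (abs_nonneg _)
  have htr : transform a ε k ω = (l.inst fun j => δ j ω).err + (r.inst fun j => δ j ω).err := by
    rw [childErr_eq_sum _ hkl hkr, transform]
    refine sum_congr rfl (fun i _ => ?_)
    simp only [ha]
    rw [h.eq_mul_unitSeq i ω]
    ring
  rw [hrad, truncTransform_eq_transform hbd, htr]
  exact hlt

omit [IsProbabilityMeasure μ] in
/-- [folklore] no failure can occur in a tree with `ñ = 0` (every child-error vanishes). -/
private theorem not_failFM_of_ntilde_eq_zero (c : ℝ) (us : ℕ → ℝ) (v : ℕ → ℝ) :
    ∀ T : STree, T.ntilde = 0 → ¬ FailFM c us v T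
  | leaf _, _ => fun hf => hf
  | node k l r, h => by
      simp only [ntilde] at h
      by_cases hb : (l.isLeaf && r.isLeaf) = true
      · obtain ⟨x, rfl⟩ := exists_eq_leaf_of_isLeaf' (Bool.and_eq_true_iff.mp hb).1
        obtain ⟨y, rfl⟩ := exists_eq_leaf_of_isLeaf' (Bool.and_eq_true_iff.mp hb).2
        simp [FailFM, FbM, PsiM]
      · simp [hb] at h

/-- **Lemma 11 in mixed precision, counting form.** For a well-labelled tree, `0 < p` and
`c = √(2 ln(2/p))`: `μ {some node k has |f_k| > F_k} ≤ ñ · p`.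
[cite: HallmanIpsen2023, §5, Theorem 26 (proof as for §2.2, Lemma 11: induction over `k`
with failure probability `(k − L − 1) η/ñ`)] -/
theorem measure_failFM_le (h : MPErrorModel μ us δ) {p c : ℝ} (hp : 0 < p)
    (hc : c = Real.sqrt (2 * Real.log (2 / p))) :
    ∀ T : STree, T.WellLabeled →
      μ {ω | FailFM c us (fun j => δ j ω) T} ≤ (T.ntilde : ℝ≥0∞) * ENNReal.ofReal p
  | leaf _, _ => by simp [FailFM]
  | node k l r, hW => by
      have ihl := measure_failFM_le h hp hc l hW.1
      have ihr := measure_failFM_le h hp hc r hW.2.1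
      by_cases hb : (l.isLeaf && r.isLeaf) = true
      · have hnt : (node k l r).ntilde = 0 := by
          obtain ⟨x, rfl⟩ := exists_eq_leaf_of_isLeaf' (Bool.and_eq_true_iff.mp hb).1
          obtain ⟨y, rfl⟩ := exists_eq_leaf_of_isLeaf' (Bool.and_eq_true_iff.mp hb).2
          simp [ntilde, isLeaf]
        have hempty : {ω | FailFM c us (fun j => δ j ω) (node k l r)} = ∅ := by
          ext ω
          simp only [Set.mem_setOf_eq, Set.mem_empty_iff_false, iff_false]
          exact not_failFM_of_ntilde_eq_zero c us _ _ hnt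
        rw [hempty, measure_empty]
        exact bot_le
      · have hnt : ((node k l r).ntilde : ℝ≥0∞) = 1 + l.ntilde + r.ntilde := by
          simp [ntilde, hb]
        have hsub : {ω | FailFM c us (fun j => δ j ω) (node k l r)}
            ⊆ ({ω | FbM c us (node k l r)
                    < |(l.inst fun j => δ j ω).err + (r.inst fun j => δ j ω).err|
                  ∧ ¬ FailFM c us (fun j => δ j ω) l ∧ ¬ FailFM c us (fun j => δ j ω) r}
              ∪ {ω | FailFM c us (fun j => δ j ω) l}) ∪ {ω | FailFM c us (fun j => δ j ω) r} := by
          intro ω hω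
          simp only [Set.mem_setOf_eq, FailFM, Set.mem_union] at hω ⊢
          tauto
        calc μ {ω | FailFM c us (fun j => δ j ω) (node k l r)}
            ≤ μ ({ω | FbM c us (node k l r)
                    < |(l.inst fun j => δ j ω).err + (r.inst fun j => δ j ω).err|
                  ∧ ¬ FailFM c us (fun j => δ j ω) l ∧ ¬ FailFM c us (fun j => δ j ω) r}
              ∪ {ω | FailFM c us (fun j => δ j ω) l}) + μ {ω | FailFM c us (fun j => δ j ω) r} :=
              (measure_mono hsub).trans (measure_union_le _ _)
          _ ≤ (ENNReal.ofReal p + (l.ntilde : ℝ≥0∞) * ENNReal.ofReal p)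
              + (r.ntilde : ℝ≥0∞) * ENNReal.ofReal p := by
              gcongr
              exact (measure_union_le _ _).trans
                (add_le_add (measure_rootFailM_le h hW hp hc) ihl)
          _ = ((node k l r).ntilde : ℝ≥0∞) * ENNReal.ofReal p := by rw [hnt]; ring

/-- **Lemma 11 in mixed precision**: with `λ_{ñ,η} = √(2 ln(2ñ/η))` as F-parameter, with
probability at least `1 − η`, `|f_k| ≤ F_k` for EVERY node `k`.
[cite: HallmanIpsen2023, §5, Theorem 26 (proof as for §2.2, Lemma 11)] -/
theorem measure_failFM_le_eta (h : MPErrorModel μ us δ) {T : STree} (hT : T.WellLabeled) {η : ℝ}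
    (hη : 0 < η) :
    μ {ω | FailFM (lam T.ntilde η) us (fun j => δ j ω) T} ≤ ENNReal.ofReal η := by
  rcases Nat.eq_zero_or_pos T.ntilde with hn | hn
  · have hempty : {ω | FailFM (lam T.ntilde η) us (fun j => δ j ω) T} = ∅ := by
      ext ω
      simp only [Set.mem_setOf_eq, Set.mem_empty_iff_false, iff_false]
      exact not_failFM_of_ntilde_eq_zero _ us _ T hn
    rw [hempty, measure_empty]
    exact bot_le
  · have hnpos : (0 : ℝ) < T.ntilde := by exact_mod_cast hn
    have hp : 0 < η / T.ntilde := div_pos hη hnpos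
    have hc : lam T.ntilde η = Real.sqrt (2 * Real.log (2 / (η / T.ntilde))) := by
      rw [lam, div_div_eq_mul_div]
    calc μ {ω | FailFM (lam T.ntilde η) us (fun j => δ j ω) T}
        ≤ (T.ntilde : ℝ≥0∞) * ENNReal.ofReal (η / T.ntilde) := measure_failFM_le h hp hc T hT
      _ = ENNReal.ofReal η := by
          rw [← ENNReal.ofReal_natCast, ← ENNReal.ofReal_mul (Nat.cast_nonneg _)]
          congr 1
          field_simp

/-- **Theorem 26 for an arbitrary F-parameter `c ≥ 0`**:
`μ {√(2 ln(2/p)) √Ψ̃_c(T) < |e|} ≤ μ {some |f_k| > F_k} + p` — Lemma 3 (relaxed Azuma–Hoeffding)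
for the martingale `Z_i = Σ_{j≤i} (s_j + f_j) u_j ε_j`, whose increments obey
`|Z_i − Z_{i−1}| ≤ u_i (|s_i| + F_i)` off the failure event.
[cite: HallmanIpsen2023, §5, Theorem 26 (proof as for §2.2, Theorem 12)] -/
theorem errBoundM_recursive_of_failFM (h : MPErrorModel μ us δ) {T : STree} (hT : T.WellLabeled)
    {c p : ℝ} (hc : 0 ≤ c) (hp : 0 < p) :
    μ {ω | Real.sqrt (2 * Real.log (2 / p)) * Real.sqrt (PsiM c us T)
        < |(T.inst fun j => δ j ω).err|}
      ≤ μ {ω | FailFM c us (fun j => δ j ω) T} + ENNReal.ofReal p := by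
  have hε := h.toUnit
  set ε := MPErrorModel.unitSeq us δ with hεdef
  set N : ℕ := T.labels.sup id + 1 with hN
  have hlab : ∀ j ∈ T.labels, j < N := fun j hj =>
    Nat.lt_succ_of_le (Finset.le_sup (f := id) hj)
  set a : ℕ → Ω → ℝ := fun i ω => coef (fun j => δ j ω) T i * us i with ha
  set A : ℕ → ℝ := fun i => coefBoundM c us T i * |us i| with hA
  have hP : IsPredictable ε a := isPredictable_rescale (isPredictable_coef hT) h.eq_mul_unitSeq us
  have hA0 : ∀ i, 0 ≤ A i := fun i => mul_nonneg (coefBoundM_nonneg hc us i T) (abs_nonneg _)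
  have hvar : ∑ i ∈ range N, (A i * 1) ^ 2 = PsiM c us T := by
    rw [← sum_sq_coefBoundM c us T hT hlab]
    exact sum_congr rfl (fun i _ => by simp only [hA, mul_one, mul_pow, sq_abs])
  have hrad : azumaRadius (∑ i ∈ range N, (A i * 1) ^ 2) p
      = Real.sqrt (2 * Real.log (2 / p)) * Real.sqrt (PsiM c us T) := by
    rw [hvar, azumaRadius]; ring
  have hsub : {ω | Real.sqrt (2 * Real.log (2 / p)) * Real.sqrt (PsiM c us T)
        < |(T.inst fun j => δ j ω).err|}
      ⊆ {ω | FailFM c us (fun j => δ j ω) T}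
        ∪ {ω | azumaRadius (∑ i ∈ range N, (A i * 1) ^ 2) p < |truncTransform a A ε N ω|} := by
    intro ω hω
    simp only [Set.mem_setOf_eq, Set.mem_union] at hω ⊢
    by_cases hF : FailFM c us (fun j => δ j ω) T
    · exact Or.inl hF
    · right
      have hbd : ∀ i < N, |a i ω| ≤ A i := fun i _ => by
        simp only [ha, hA, abs_mul]
        exact mul_le_mul_of_nonneg_right (abs_coef_le_coefBoundM _ hc us i T hF) (abs_nonneg _)
      have htr : transform a ε N ω = (T.inst fun j => δ j ω).err := by
        rw [err_inst_eq_sum _ T hlab, transform]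
        refine sum_congr rfl (fun i _ => ?_)
        simp only [ha]
        rw [h.eq_mul_unitSeq i ω]
        ring
      rw [hrad, truncTransform_eq_transform hbd, htr]
      exact hω
  calc μ {ω | Real.sqrt (2 * Real.log (2 / p)) * Real.sqrt (PsiM c us T)
          < |(T.inst fun j => δ j ω).err|}
      ≤ μ {ω | FailFM c us (fun j => δ j ω) T}
        + μ {ω | azumaRadius (∑ i ∈ range N, (A i * 1) ^ 2) p < |truncTransform a A ε N ω|} :=
        (measure_mono hsub).trans (measure_union_le _ _)
    _ ≤ μ {ω | FailFM c us (fun j => δ j ω) T} + ENNReal.ofReal p := by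
        gcongr
        exact azumaHoeffding_trunc hε hP hA0 N hp

/-- **Theorem 26 with `λ_{ñ,η}`** (the §2.2 Theorem 12 form, sharper than the printed `λ_{n,η}`):
under the mixed-precision model, for a well-labelled tree and `0 < η`, `0 < p`, with probability at
least `1 − (p + η)`, `|e_n| ≤ √(2 ln(2/p)) (Σ_j u_j² (|s_j| + F_{j,ñ,η})²)^{1/2}`.
[cite: HallmanIpsen2023, §5, Theorem 26 (t_51) with §2.2, Theorem 12's `λ_{ñ,η}`] -/
theorem errBoundM_recursive_ntilde (h : MPErrorModel μ us δ) {T : STree} (hT : T.WellLabeled)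
    {η p : ℝ} (hη : 0 < η) (hp : 0 < p) :
    μ {ω | Real.sqrt (2 * Real.log (2 / p)) * Real.sqrt (PsiM (lam T.ntilde η) us T)
        < |(T.inst fun j => δ j ω).err|} ≤ ENNReal.ofReal (p + η) := by
  calc _ ≤ μ {ω | FailFM (lam T.ntilde η) us (fun j => δ j ω) T} + ENNReal.ofReal p :=
        errBoundM_recursive_of_failFM h hT (lam_nonneg _ _) hp
    _ ≤ ENNReal.ofReal η + ENNReal.ofReal p := by
        gcongr; exact measure_failFM_le_eta h hT hη
    _ = ENNReal.ofReal (p + η) := by rw [ENNReal.ofReal_add hp.le hη.le, add_comm]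

/-- **THEOREM 26 (Hallman–Ipsen): recursive probabilistic error bound for summation in mixed
precision.** Under the mixed-precision model (`|δ_k| ≤ u_k`, mean-independent zero-mean roundoffs),
for a well-labelled summation tree with `n` inputs and `0 < η`, `0 < p` (HI's `δ`): with
probability at least `1 − (p + η)`,
`|e_n| ≤ √(2 ln(2/p)) (Σ_{j=2}^n u_j² (|s_j| + F_{j,n,η})²)^{1/2}`, where
`F_{k,n,η} = λ_{n,η} (Σ_{j≺k} u_j² (|s_j| + F_{j,n,η})²)^{1/2}` (`0` at a node with two leaf
children), `λ_{n,η} = √(2 ln(2n/η))`; as a tail bound, `μ {√(2 ln(2/p)) √Ψ̃ < |e_n|} ≤ p + η` with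
`Ψ̃ = PsiM (lam n η) us T`. [cite: HallmanIpsen2023, §5, Theorem 26 (t_51, Thm. 26 of the arXiv
text), eq. for `|e_n|` and the recurrence for `F_{k,n,η}`] -/
theorem errBoundM_recursive (h : MPErrorModel μ us δ) {T : STree} (hT : T.WellLabeled)
    {η p : ℝ} (hη : 0 < η) (hp : 0 < p) :
    μ {ω | Real.sqrt (2 * Real.log (2 / p)) * Real.sqrt (PsiM (lam T.numInputs η) us T)
        < |(T.inst fun j => δ j ω).err|} ≤ ENNReal.ofReal (p + η) := by
  refine (measure_mono ?_).trans (errBoundM_recursive_ntilde h hT hη hp)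
  intro ω hω
  simp only [Set.mem_setOf_eq] at hω ⊢
  refine lt_of_le_of_lt (mul_le_mul_of_nonneg_left (Real.sqrt_le_sqrt (PsiM_mono
    (lam_nonneg _ _) ?_ us T)) (Real.sqrt_nonneg _)) hω
  exact lam_mono (ntilde_lt_numInputs T).le hη

end ProbabilisticM

/-! ### The closed form (proof of THEOREM 27): weighted chain sums, Minkowski, the product bound -/

section ClosedFormM

variable (us : ℕ → ℝ)

/-- WEIGHTED LEVEL SUMS `Σ_{chains j_0 ≻ j_1 ≻ ⋯ ≻ j_m} (u_{j_0} ⋯ u_{j_{m−1}})² W(j_m)` over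
descending chains of `m + 1` nodes — the sums `Σ_k T_{k,m}² (u_k² s_k²)` of the proof of Theorem 27
(`T_{k,j}² = Σ_{k≺ℓ_1≺⋯≺ℓ_j⪯n} (u_{ℓ_1} ⋯ u_{ℓ_j})²`), defined by the recursion
`levelM(node k, m+1) = u_k² (levelM(l, m) + levelM(r, m)) + levelM(l, m+1) + levelM(r, m+1)`.
[cite: HallmanIpsen2023, §5, Theorem 27, proof, eq. (eqn:mixPrecError) and the definition of
`T_{k,j}`] -/
def levelM (W : STree → ℝ) : STree → ℕ → ℝ
  | leaf _, _ => 0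
  | node k l r, 0 => W (node k l r) + levelM W l 0 + levelM W r 0
  | node k l r, m + 1 => us k ^ 2 * (levelM W l m + levelM W r m)
      + levelM W l (m + 1) + levelM W r (m + 1)

/-- Node weight `u_j² (|s_j| + F_j)²`. [cite: HallmanIpsen2023, §5, Theorem 27, proof] -/
noncomputable def wPM (c : ℝ) : STree → ℝ
  | leaf _ => 0
  | node k l r => us k ^ 2 * (|exactVal l + exactVal r| + FbM c us (node k l r)) ^ 2

/-- Node weight `u_j² s_j²`. [cite: HallmanIpsen2023, §5, Theorem 27, proof] -/
def wSM : STree → ℝ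
  | leaf _ => 0
  | node k l r => us k ^ 2 * (exactVal l + exactVal r) ^ 2

/-- Node weight `u_j² F_j²`. [cite: HallmanIpsen2023, §5, Theorem 27, proof] -/
noncomputable def wQM (c : ℝ) : STree → ℝ
  | leaf _ => 0
  | node k l r => us k ^ 2 * FbM c us (node k l r) ^ 2

/-- The ANCESTOR-PRODUCT expansion `Σ_k W(k) ∏_{k≺ℓ⪯n} (1 + q u_ℓ²)` (recursion
`expandM(node k) = W(node k) + (1 + q u_k²)(expandM l + expandM r)`): with `q = 2λ²` and
`W = u_k² s_k²` this is `Σ_k (Σ_{j≥0} 2^j λ^{2j} T_{k,j}²) u_k² s_k²`.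
[cite: HallmanIpsen2023, §5, Theorem 27, proof (the display
`Σ_{j=1}^h 2^j λ^{2j} T_{k,j}² = ∏_{k≺ℓ⪯n} (1 + 2λ² u_ℓ²) − 1`)] -/
def expandM (q : ℝ) (W : STree → ℝ) : STree → ℝ
  | leaf _ => 0
  | node k l r => W (node k l r) + (1 + q * us k ^ 2) * (expandM q W l + expandM q W r)

/-- [folklore] weighted level sums of a leaf vanish. -/
@[simp] private theorem levelM_leaf (W : STree → ℝ) (x : ℝ) (m : ℕ) :
    levelM us W (leaf x) m = 0 := by
  cases m <;> rfl

/-- [folklore] weighted level sums of nonnegative weights are nonnegative. -/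
private theorem levelM_nonneg {W : STree → ℝ} (hW : ∀ S, 0 ≤ W S) : ∀ (T : STree) (m : ℕ),
    0 ≤ levelM us W T m
  | leaf _, m => by simp
  | node k l r, 0 => by
      simp only [levelM]
      exact add_nonneg (add_nonneg (hW _) (levelM_nonneg hW l 0)) (levelM_nonneg hW r 0)
  | node k l r, m + 1 => by
      simp only [levelM]
      have := levelM_nonneg hW l m; have := levelM_nonneg hW r m
      have := levelM_nonneg hW l (m+1); have := levelM_nonneg hW r (m+1)
      positivity

/-- [folklore] the ancestor-product expansion of nonnegative weights is nonnegative (`q ≥ 0`). -/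
private theorem expandM_nonneg {q : ℝ} (hq : 0 ≤ q) {W : STree → ℝ} (hW : ∀ S, 0 ≤ W S) :
    ∀ T : STree, 0 ≤ expandM us q W T
  | leaf _ => le_rfl
  | node k l r => by
      simp only [expandM]
      have := hW (node k l r)
      have := expandM_nonneg hq hW l; have := expandM_nonneg hq hW r
      positivity

/-- [folklore] `u² (|s| + F)² ≥ 0`. -/
private theorem wPM_nonneg (c : ℝ) (S : STree) : 0 ≤ wPM us c S := by
  cases S <;> simp only [wPM] <;> positivity

/-- [folklore] `u² s² ≥ 0`. -/
private theorem wSM_nonneg (S : STree) : 0 ≤ wSM us S := by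
  cases S <;> simp only [wSM] <;> positivity

/-- [folklore] `u² F² ≥ 0`. -/
private theorem wQM_nonneg (c : ℝ) (S : STree) : 0 ≤ wQM us c S := by
  cases S <;> simp only [wQM] <;> positivity

/-- Level `0` of the weights `u_j² (|s_j| + F_j)²` is `Ψ̃`. [cite: HallmanIpsen2023, §5,
Theorem 27, proof (`j = 0` term of eq. (eqn:mixPrecError))] -/
theorem levelM_wPM_zero (c : ℝ) : ∀ T : STree, levelM us (wPM us c) T 0 = PsiM c us T
  | leaf _ => by simp [PsiM]
  | node k l r => by
      simp only [levelM, wPM, PsiM_node, levelM_wPM_zero c l, levelM_wPM_zero c r]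

/-- Level `0` of the weights `u_j² s_j²` is `Σ u_k² s_k²`. [cite: HallmanIpsen2023, §5, Theorem 27,
proof (`T_{k,0} = 1`)] -/
theorem levelM_wSM_zero : ∀ T : STree, levelM us (wSM us) T 0 = sumSqM us T
  | leaf _ => by simp [sumSqM]
  | node k l r => by simp only [levelM, wSM, sumSqM, levelM_wSM_zero l, levelM_wSM_zero r]

/-- **The F-recursion, one weighted level down**:
`Σ_{chains} wt · u² F² = c² · Σ_{chains one longer} wt' · u² (|s| + F)²`
(`F_j² = c² Σ_{i≺j} u_i² (|s_i| + F_i)²`). [cite: HallmanIpsen2023, §5, Theorem 27, proof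
("Repeated application of the 2-norm triangle inequality" with the recurrence of Theorem 26)] -/
theorem levelM_wQM (c : ℝ) : ∀ (T : STree) (m : ℕ),
    levelM us (wQM us c) T m = c ^ 2 * levelM us (wPM us c) T (m + 1)
  | leaf _, m => by simp
  | node k l r, 0 => by
      have hF : FbM c us (node k l r) ^ 2 = c ^ 2 * (PsiM c us l + PsiM c us r) := by
        simp only [FbM]
        rw [mul_pow, Real.sq_sqrt (add_nonneg (PsiM_nonneg c us l) (PsiM_nonneg c us r))]
      simp only [levelM, wQM, levelM_wQM c l 0, levelM_wQM c r 0, levelM_wPM_zero, hF]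
      ring
  | node k l r, m + 1 => by
      simp only [levelM, levelM_wQM c l, levelM_wQM c r]
      ring

/-- [folklore] Minkowski's inequality is additive: the 2-norm triangle inequality for a
concatenation follows from the two halves (Cauchy–Schwarz in the plane). -/
private theorem mink_add' {P₁ P₂ S₁ S₂ Q₁ Q₂ : ℝ} (hP₁ : 0 ≤ P₁) (hP₂ : 0 ≤ P₂) (hS₁ : 0 ≤ S₁)
    (hS₂ : 0 ≤ S₂) (hQ₁ : 0 ≤ Q₁) (hQ₂ : 0 ≤ Q₂)
    (h₁ : Real.sqrt P₁ ≤ Real.sqrt S₁ + Real.sqrt Q₁)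
    (h₂ : Real.sqrt P₂ ≤ Real.sqrt S₂ + Real.sqrt Q₂) :
    Real.sqrt (P₁ + P₂) ≤ Real.sqrt (S₁ + S₂) + Real.sqrt (Q₁ + Q₂) := by
  set a := Real.sqrt S₁ with ha
  set b := Real.sqrt S₂ with hb
  set x := Real.sqrt Q₁ with hx
  set y := Real.sqrt Q₂ with hy
  have ha0 : 0 ≤ a := Real.sqrt_nonneg _
  have hb0 : 0 ≤ b := Real.sqrt_nonneg _
  have hx0 : 0 ≤ x := Real.sqrt_nonneg _
  have hy0 : 0 ≤ y := Real.sqrt_nonneg _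
  have ha2 : a ^ 2 = S₁ := Real.sq_sqrt hS₁
  have hb2 : b ^ 2 = S₂ := Real.sq_sqrt hS₂
  have hx2 : x ^ 2 = Q₁ := Real.sq_sqrt hQ₁
  have hy2 : y ^ 2 = Q₂ := Real.sq_sqrt hQ₂
  have e₁ : P₁ ≤ (a + x) ^ 2 := by
    have := Real.sq_sqrt hP₁
    nlinarith [Real.sqrt_nonneg P₁]
  have e₂ : P₂ ≤ (b + y) ^ 2 := by
    have := Real.sq_sqrt hP₂
    nlinarith [Real.sqrt_nonneg P₂]
  have cs : a * x + b * y ≤ Real.sqrt (S₁ + S₂) * Real.sqrt (Q₁ + Q₂) := by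
    rw [← Real.sqrt_mul (add_nonneg hS₁ hS₂)]
    refine (le_abs_self _).trans (Real.abs_le_sqrt ?_)
    rw [← ha2, ← hb2, ← hx2, ← hy2]
    nlinarith [sq_nonneg (a * y - b * x)]
  have hXY : 0 ≤ Real.sqrt (S₁ + S₂) + Real.sqrt (Q₁ + Q₂) := by positivity
  rw [Real.sqrt_le_left hXY]
  have hX2 : Real.sqrt (S₁ + S₂) ^ 2 = S₁ + S₂ := Real.sq_sqrt (add_nonneg hS₁ hS₂)
  have hY2 : Real.sqrt (Q₁ + Q₂) ^ 2 = Q₁ + Q₂ := Real.sq_sqrt (add_nonneg hQ₁ hQ₂)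
  nlinarith [e₁, e₂, cs, hX2, hY2, ha2, hb2, hx2, hy2]

/-- [folklore] Minkowski's inequality is homogeneous: scaling all three radicands by `t ≥ 0`. -/
private theorem mink_scale {t P S Q : ℝ} (ht : 0 ≤ t)
    (h : Real.sqrt P ≤ Real.sqrt S + Real.sqrt Q) :
    Real.sqrt (t * P) ≤ Real.sqrt (t * S) + Real.sqrt (t * Q) := by
  rw [Real.sqrt_mul ht, Real.sqrt_mul ht, Real.sqrt_mul ht, ← mul_add]
  exact mul_le_mul_of_nonneg_left h (Real.sqrt_nonneg _)

/-- **Minkowski per weighted level**: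
`(Σ wt u²(|s| + F)²)^{1/2} ≤ (Σ wt u² s²)^{1/2} + (Σ wt u² F²)^{1/2}` ("Repeated application of the
2-norm triangle inequality"). [cite: HallmanIpsen2023, §5, Theorem 27, proof, first sentence] -/
theorem sqrt_levelM_wPM_le {c : ℝ} (hc : 0 ≤ c) : ∀ (T : STree) (m : ℕ),
    Real.sqrt (levelM us (wPM us c) T m)
      ≤ Real.sqrt (levelM us (wSM us) T m) + Real.sqrt (levelM us (wQM us c) T m)
  | leaf _, m => by simp
  | node k l r, 0 => by
      simp only [levelM]
      have hatom : Real.sqrt (wPM us c (node k l r)) ≤ Real.sqrt (wSM us (node k l r))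
          + Real.sqrt (wQM us c (node k l r)) := by
        simp only [wPM, wSM, wQM]
        refine mink_scale (sq_nonneg _) ?_
        rw [Real.sqrt_sq (add_nonneg (abs_nonneg _) (FbM_nonneg hc us _)), Real.sqrt_sq_eq_abs,
          Real.sqrt_sq (FbM_nonneg hc us _)]
      exact mink_add' (add_nonneg (wPM_nonneg us c _) (levelM_nonneg us (wPM_nonneg us c) l 0))
        (levelM_nonneg us (wPM_nonneg us c) r 0)
        (add_nonneg (wSM_nonneg us _) (levelM_nonneg us (wSM_nonneg us) l 0))
        (levelM_nonneg us (wSM_nonneg us) r 0)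
        (add_nonneg (wQM_nonneg us c _) (levelM_nonneg us (wQM_nonneg us c) l 0))
        (levelM_nonneg us (wQM_nonneg us c) r 0)
        (mink_add' (wPM_nonneg us c _) (levelM_nonneg us (wPM_nonneg us c) l 0) (wSM_nonneg us _)
          (levelM_nonneg us (wSM_nonneg us) l 0) (wQM_nonneg us c _)
          (levelM_nonneg us (wQM_nonneg us c) l 0)
          hatom (sqrt_levelM_wPM_le hc l 0))
        (sqrt_levelM_wPM_le hc r 0)
  | node k l r, m + 1 => by
      simp only [levelM]
      have hPl := levelM_nonneg us (wPM_nonneg us c) l m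
      have hPr := levelM_nonneg us (wPM_nonneg us c) r m
      have hPl' := levelM_nonneg us (wPM_nonneg us c) l (m + 1)
      have hPr' := levelM_nonneg us (wPM_nonneg us c) r (m + 1)
      have hSl := levelM_nonneg us (wSM_nonneg us) l m
      have hSr := levelM_nonneg us (wSM_nonneg us) r m
      have hSl' := levelM_nonneg us (wSM_nonneg us) l (m + 1)
      have hSr' := levelM_nonneg us (wSM_nonneg us) r (m + 1)
      have hQl := levelM_nonneg us (wQM_nonneg us c) l m
      have hQr := levelM_nonneg us (wQM_nonneg us c) r m
      have hQl' := levelM_nonneg us (wQM_nonneg us c) l (m + 1)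
      have hQr' := levelM_nonneg us (wQM_nonneg us c) r (m + 1)
      have hu : 0 ≤ us k ^ 2 := sq_nonneg _
      have hsc : Real.sqrt (us k ^ 2 * (levelM us (wPM us c) l m + levelM us (wPM us c) r m))
          ≤ Real.sqrt (us k ^ 2 * (levelM us (wSM us) l m + levelM us (wSM us) r m))
            + Real.sqrt (us k ^ 2 * (levelM us (wQM us c) l m + levelM us (wQM us c) r m)) :=
        mink_scale hu (mink_add' hPl hPr hSl hSr hQl hQr (sqrt_levelM_wPM_le hc l m)
          (sqrt_levelM_wPM_le hc r m))
      exact mink_add' (add_nonneg (mul_nonneg hu (add_nonneg hPl hPr)) hPl') hPr'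
        (add_nonneg (mul_nonneg hu (add_nonneg hSl hSr)) hSl') hSr'
        (add_nonneg (mul_nonneg hu (add_nonneg hQl hQr)) hQl') hQr'
        (mink_add' (mul_nonneg hu (add_nonneg hPl hPr)) hPl' (mul_nonneg hu (add_nonneg hSl hSr))
          hSl' (mul_nonneg hu (add_nonneg hQl hQr)) hQl' hsc (sqrt_levelM_wPM_le hc l (m + 1)))
        (sqrt_levelM_wPM_le hc r (m + 1))

/-- Chains of `m + 1` nodes need height `> m`: the weighted level sums vanish from level `h` on.
[cite: HallmanIpsen2023, §5, Theorem 27, proof (the sum `Σ_{j=0}^h`)] -/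
theorem levelM_eq_zero_of_height_le (W : STree → ℝ) : ∀ (T : STree) (m : ℕ), T.height ≤ m →
    levelM us W T m = 0
  | leaf _, m, _ => by simp
  | node k l r, 0, h => by simp [height] at h
  | node k l r, m + 1, h => by
      simp only [height] at h
      have hl : l.height ≤ m := by omega
      have hr : r.height ≤ m := by omega
      simp only [levelM, levelM_eq_zero_of_height_le W l m hl, levelM_eq_zero_of_height_le W r m hr,
        levelM_eq_zero_of_height_le W l (m + 1) (by omega),
        levelM_eq_zero_of_height_le W r (m + 1) (by omega), mul_zero, add_zero]

/-- **Unrolling the F-recursion** (`M` levels):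
`√Ψ̃ ≤ Σ_{m<M} c^m (Σ_{level m} wt u² s²)^{1/2} + c^M (Σ_{level M} wt u² (|s| + F)²)^{1/2}`.
[cite: HallmanIpsen2023, §5, Theorem 27, proof, eq. (eqn:mixPrecError)] -/
theorem sqrt_PsiM_le_unroll {c : ℝ} (hc : 0 ≤ c) (T : STree) : ∀ M : ℕ,
    Real.sqrt (PsiM c us T) ≤ (∑ m ∈ range M, c ^ m * Real.sqrt (levelM us (wSM us) T m))
      + c ^ M * Real.sqrt (levelM us (wPM us c) T M)
  | 0 => by simp [levelM_wPM_zero]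
  | M + 1 => by
      have ih := sqrt_PsiM_le_unroll hc T M
      have hstep : Real.sqrt (levelM us (wPM us c) T M)
          ≤ Real.sqrt (levelM us (wSM us) T M)
            + c * Real.sqrt (levelM us (wPM us c) T (M + 1)) := by
        have h1 := sqrt_levelM_wPM_le us hc T M
        rwa [levelM_wQM, Real.sqrt_mul (sq_nonneg c), Real.sqrt_sq hc] at h1
      rw [sum_range_succ, pow_succ]
      have hcM : 0 ≤ c ^ M := pow_nonneg hc M
      nlinarith [mul_le_mul_of_nonneg_left hstep hcM]

/-- [folklore] splitting `Σ_{m≤M} q^m levelM(node k l r, m)` along the recursion for `levelM`. -/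
private theorem sum_levelM_node (q : ℝ) (W : STree → ℝ) (k : ℕ) (l r : STree) : ∀ M : ℕ,
    ∑ m ∈ range (M + 1), q ^ m * levelM us W (node k l r) m
      = W (node k l r) + ∑ m ∈ range (M + 1), q ^ m * levelM us W l m
        + ∑ m ∈ range (M + 1), q ^ m * levelM us W r m
        + q * us k ^ 2 * (∑ m ∈ range M, q ^ m * levelM us W l m
          + ∑ m ∈ range M, q ^ m * levelM us W r m)
  | 0 => by simp [levelM]
  | M + 1 => by
      rw [sum_range_succ, sum_levelM_node q W k l r M,
        sum_range_succ (fun m => q ^ m * levelM us W l m) (M + 1),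
        sum_range_succ (fun m => q ^ m * levelM us W r m) (M + 1),
        sum_range_succ (fun m => q ^ m * levelM us W l m) M,
        sum_range_succ (fun m => q ^ m * levelM us W r m) M]
      simp only [levelM, pow_succ]
      ring

/-- **Swapping the order of summation**: for `q ≥ 0` and nonnegative node weights,
`Σ_{m=0}^{M} q^m Σ_{chains of length m} wt · W ≤ Σ_k W(k) ∏_{k≺ℓ⪯n} (1 + q u_ℓ²)` (with
equality once `M ≥ h`): every ascending chain above `k` is a sub-product of
`∏_{ℓ ≻ k} (1 + q u_ℓ²)`.
[cite: HallmanIpsen2023, §5, Theorem 27, proof ("swap the order of summation",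
`Σ_{j=1}^h 2^j λ^{2j} T_{k,j}² = ∏_{k≺ℓ⪯n} (1 + 2λ² u_ℓ²) − 1`)] -/
theorem sum_levelM_le_expandM {q : ℝ} (hq : 0 ≤ q) {W : STree → ℝ} (hW : ∀ S, 0 ≤ W S) :
    ∀ (T : STree) (M : ℕ), ∑ m ∈ range (M + 1), q ^ m * levelM us W T m ≤ expandM us q W T
  | leaf _, M => by simp [expandM]
  | node k l r, M => by
      rw [sum_levelM_node, expandM]
      have ihl := sum_levelM_le_expandM hq hW l M
      have ihr := sum_levelM_le_expandM hq hW r M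
      have hmono : ∀ S : STree, ∑ m ∈ range M, q ^ m * levelM us W S m
          ≤ ∑ m ∈ range (M + 1), q ^ m * levelM us W S m := fun S => by
        rw [sum_range_succ]
        exact le_add_of_nonneg_right (mul_nonneg (pow_nonneg hq M) (levelM_nonneg us hW S M))
      have ihl' := (hmono l).trans ihl
      have ihr' := (hmono r).trans ihr
      have hqu : 0 ≤ q * us k ^ 2 := mul_nonneg hq (sq_nonneg _)
      nlinarith [mul_le_mul_of_nonneg_left (add_le_add ihl' ihr') hqu]

/-- **The exponential bound on the ancestor products**:
`∏_{k≺ℓ⪯n} (1 + q u_ℓ²) ≤ exp(q h̃_k) ≤ exp(q h̃)` for every node `k` (`h̃_k` its weighted depth),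
hence
`Σ_k W(k) ∏_{k≺ℓ⪯n} (1 + q u_ℓ²) ≤ exp(q h̃) Σ_k W(k)`; stated with an offset `D ≥ 0` for the
weighted depth already accumulated above the subtree.
[cite: HallmanIpsen2023, §5, Theorem 27, proof (`≤ exp(2λ² h̃_k) − 1`, "Insert the bounds
`h̃_k ≤ h̃`")] -/
theorem expandM_le_exp {q : ℝ} (hq : 0 ≤ q) {W : STree → ℝ} (hW : ∀ S, 0 ≤ W S) :
    ∀ (T : STree) (D : ℝ), 0 ≤ D →
      Real.exp (q * D) * expandM us q W T
        ≤ Real.exp (q * (D + wHeight us T)) * levelM us W T 0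
  | leaf _, D, _ => by simp [expandM]
  | node k l r, D, hD => by
      simp only [expandM, levelM, wHeight]
      have hD' : 0 ≤ D + us k ^ 2 := add_nonneg hD (sq_nonneg _)
      have ihl := expandM_le_exp hq hW l (D + us k ^ 2) hD'
      have ihr := expandM_le_exp hq hW r (D + us k ^ 2) hD'
      have hEl := expandM_nonneg us hq hW l
      have hEr := expandM_nonneg us hq hW r
      have hL l' := levelM_nonneg us hW l' 0
      -- `exp(qD)(1 + q u²) ≤ exp(q(D + u²))`
      have h1 : Real.exp (q * D) * (1 + q * us k ^ 2) ≤ Real.exp (q * (D + us k ^ 2)) := by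
        rw [show q * (D + us k ^ 2) = q * D + q * us k ^ 2 by ring, Real.exp_add]
        exact mul_le_mul_of_nonneg_left (by linarith [Real.add_one_le_exp (q * us k ^ 2)])
          (Real.exp_nonneg _)
      -- monotonicity of `exp` in the weighted height
      set H := us k ^ 2 + max (wHeight us l) (wHeight us r) with hH
      have hexpW : Real.exp (q * D) ≤ Real.exp (q * (D + H)) :=
        Real.exp_le_exp.mpr (mul_le_mul_of_nonneg_left (le_add_of_nonneg_right
          (add_nonneg (sq_nonneg _) ((wHeight_nonneg us l).trans (le_max_left _ _)))) hq)
      have hexpl : Real.exp (q * (D + us k ^ 2 + wHeight us l)) ≤ Real.exp (q * (D + H)) :=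
        Real.exp_le_exp.mpr (mul_le_mul_of_nonneg_left (by
          rw [hH]; linarith [le_max_left (wHeight us l) (wHeight us r)]) hq)
      have hexpr : Real.exp (q * (D + us k ^ 2 + wHeight us r)) ≤ Real.exp (q * (D + H)) :=
        Real.exp_le_exp.mpr (mul_le_mul_of_nonneg_left (by
          rw [hH]; linarith [le_max_right (wHeight us l) (wHeight us r)]) hq)
      calc Real.exp (q * D) * (W (node k l r)
            + (1 + q * us k ^ 2) * (expandM us q W l + expandM us q W r))
          = Real.exp (q * D) * W (node k l r)
            + (Real.exp (q * D) * (1 + q * us k ^ 2)) * (expandM us q W l + expandM us q W r) := by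
            ring
        _ ≤ Real.exp (q * (D + H)) * W (node k l r)
            + Real.exp (q * (D + us k ^ 2)) * (expandM us q W l + expandM us q W r) :=
            add_le_add (mul_le_mul_of_nonneg_right hexpW (hW _))
              (mul_le_mul_of_nonneg_right h1 (add_nonneg hEl hEr))
        _ = Real.exp (q * (D + H)) * W (node k l r)
            + (Real.exp (q * (D + us k ^ 2)) * expandM us q W l
              + Real.exp (q * (D + us k ^ 2)) * expandM us q W r) := by ring
        _ ≤ Real.exp (q * (D + H)) * W (node k l r)
            + (Real.exp (q * (D + H)) * levelM us W l 0
              + Real.exp (q * (D + H)) * levelM us W r 0) :=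
            add_le_add le_rfl (add_le_add
              (ihl.trans (mul_le_mul_of_nonneg_right hexpl (hL l)))
              (ihr.trans (mul_le_mul_of_nonneg_right hexpr (hL r))))
        _ = Real.exp (q * (D + H)) * (W (node k l r) + levelM us W l 0 + levelM us W r 0) := by
            ring

/-- [folklore] the geometric sum `Σ_{m<h} (1/2)^{m+1} = 1 − (1/2)^h ≤ 1`. -/
private theorem geom_half_le_one' (h : ℕ) : ∑ m ∈ range h, (1 / 2 : ℝ) ^ (m + 1) ≤ 1 := by
  have : ∑ m ∈ range h, (1 / 2 : ℝ) ^ (m + 1) = 1 - (1 / 2) ^ h := by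
    induction h with
    | zero => simp
    | succ n ih => rw [sum_range_succ, ih]; ring
  rw [this]
  have : (0 : ℝ) ≤ (1 / 2) ^ h := by positivity
  linarith

/-- [folklore] `e^y − 1 ≤ y e^y` (for every real `y`, from `1 − y ≤ e^{−y}`). -/
private theorem exp_sub_one_le_mul_exp' (y : ℝ) : Real.exp y - 1 ≤ y * Real.exp y := by
  have h1 : -y + 1 ≤ Real.exp (-y) := Real.add_one_le_exp (-y)
  have h2 : Real.exp (-y) * Real.exp y = 1 := by rw [← Real.exp_add]; simp
  nlinarith [Real.exp_pos y, Real.exp_pos (-y)]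

/-- **The tail of the unrolled bound** (Cauchy–Schwarz with weights `2^m`, the product identity and
the exponential bound): for `c ≥ 0`,
`Σ_{m=1}^{h−1} c^m (Σ_{level m} wt u² s²)^{1/2} ≤ c √(2h̃) exp(c² h̃) (Σ_k u_k² s_k²)^{1/2}`.
[cite: HallmanIpsen2023, §5, Theorem 27, proof, eq. (eqn:mixPrecSum) and the two displays after
it] -/
theorem tail_le_phiM {c : ℝ} (hc : 0 ≤ c) (T : STree) (h : ℕ) :
    ∑ m ∈ range h, c ^ (m + 1) * Real.sqrt (levelM us (wSM us) T (m + 1))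
      ≤ c * Real.sqrt (2 * wHeight us T) * Real.exp (c ^ 2 * wHeight us T)
        * Real.sqrt (sumSqM us T) := by
  set H := wHeight us T with hHdef
  set L : ℕ → ℝ := fun m => levelM us (wSM us) T m with hL
  have hH0 : 0 ≤ H := wHeight_nonneg us T
  have hL0 : ∀ m, 0 ≤ L m := fun m => levelM_nonneg us (wSM_nonneg us) T m
  set R : ℝ := ∑ m ∈ range h, c ^ (m + 1) * Real.sqrt (L (m + 1)) with hR
  have hR0 : 0 ≤ R := sum_nonneg (fun m _ => by positivity)
  -- Cauchy–Schwarz with weights `(1/2)^(m+1)` and `2^(m+1)`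
  have hCS : R ^ 2 ≤ (∑ m ∈ range h, (1 / 2 : ℝ) ^ (m + 1))
      * ∑ m ∈ range h, (2 : ℝ) ^ (m + 1) * (c ^ (m + 1)) ^ 2 * L (m + 1) := by
    refine sum_sq_le_sum_mul_sum_of_sq_le_mul (range h) (fun m _ => by positivity)
      (fun m _ => by have := hL0 (m + 1); positivity) (fun m _ => le_of_eq ?_)
    rw [mul_pow, Real.sq_sqrt (hL0 _)]
    have : (1 / 2 : ℝ) ^ (m + 1) * 2 ^ (m + 1) = 1 := by
      rw [← mul_pow]; norm_num
    calc (c ^ (m + 1)) ^ 2 * L (m + 1)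
        = ((1 / 2 : ℝ) ^ (m + 1) * 2 ^ (m + 1)) * ((c ^ (m + 1)) ^ 2 * L (m + 1)) := by
          rw [this, one_mul]
      _ = _ := by ring
  -- the product identity and the exponential bound:
  -- `Σ_{m<h} (2c²)^(m+1) L(m+1) ≤ expandM(2c²) − L 0 ≤ (e^{2c²H} − 1) L 0`
  set q : ℝ := 2 * c ^ 2 with hq
  have hq0 : 0 ≤ q := by positivity
  have hsum : ∑ m ∈ range h, (2 : ℝ) ^ (m + 1) * (c ^ (m + 1)) ^ 2 * L (m + 1)
      = ∑ m ∈ range (h + 1), q ^ m * L m - L 0 := by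
    rw [sum_range_succ']
    simp only [pow_zero, one_mul, add_sub_cancel_right]
    exact sum_congr rfl (fun m _ => by rw [hq, mul_pow, ← pow_mul, pow_succ, pow_succ]; ring)
  have hexp : ∑ m ∈ range (h + 1), q ^ m * L m ≤ Real.exp (q * H) * L 0 := by
    have h1 := sum_levelM_le_expandM us hq0 (wSM_nonneg us) T h
    have h2 := expandM_le_exp us hq0 (wSM_nonneg us) T 0 le_rfl
    rw [mul_zero, Real.exp_zero, one_mul, zero_add] at h2
    exact h1.trans h2
  set y : ℝ := q * H with hy
  have hR2 : R ^ 2 ≤ y * Real.exp y * L 0 := by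
    calc R ^ 2 ≤ 1 * (Real.exp y * L 0 - L 0) := by
          refine hCS.trans ?_
          rw [hsum]
          exact mul_le_mul (geom_half_le_one' h) (by linarith) (by
            rw [← hsum]; exact sum_nonneg (fun m _ => by have := hL0 (m + 1); positivity))
            zero_le_one
      _ = (Real.exp y - 1) * L 0 := by ring
      _ ≤ y * Real.exp y * L 0 := mul_le_mul_of_nonneg_right (exp_sub_one_le_mul_exp' y) (hL0 0)
  -- `y e^y L 0 = (c √(2H) exp(c²H) √(L 0))²`
  have hsq : (c * Real.sqrt (2 * H) * Real.exp (c ^ 2 * H) * Real.sqrt (L 0)) ^ 2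
      = y * Real.exp y * L 0 := by
    rw [mul_pow, mul_pow, mul_pow, Real.sq_sqrt (by positivity), Real.sq_sqrt (hL0 0),
      ← Real.exp_nat_mul]
    push_cast
    rw [show (2 : ℝ) * (c ^ 2 * H) = y by rw [hy, hq]; ring, hy, hq]
    ring
  have hrhs : 0 ≤ c * Real.sqrt (2 * H) * Real.exp (c ^ 2 * H) * Real.sqrt (L 0) := by positivity
  have hfin := (sq_le_sq₀ hR0 hrhs).mp (hsq ▸ hR2)
  simpa [hL, levelM_wSM_zero] using hfin

/-- **The closed-form deterministic factor**: for every `c ≥ 0`,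
`√Ψ̃_c(T) ≤ (1 + c √(2h̃) exp(c² h̃)) (Σ_k u_k² s_k²)^{1/2} = (1 + φ) (Σ_k u_k² s_k²)^{1/2}`.
[cite: HallmanIpsen2023, §5, Theorem 27, proof ("combine this inequality with
(eqn:mixPrecError)")] -/
theorem sqrt_PsiM_le_closedForm {c : ℝ} (hc : 0 ≤ c) (T : STree) :
    Real.sqrt (PsiM c us T) ≤ (1 + phiM c (wHeight us T)) * Real.sqrt (sumSqM us T) := by
  rcases Nat.eq_zero_or_pos T.height with h0 | hpos
  · -- a single input: everything vanishes
    have hP : PsiM c us T = 0 := by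
      rw [← levelM_wPM_zero us c T]
      exact levelM_eq_zero_of_height_le us _ T 0 h0.le
    rw [hP, Real.sqrt_zero]
    exact mul_nonneg (add_nonneg zero_le_one (phiM_nonneg hc _)) (Real.sqrt_nonneg _)
  · obtain ⟨h, hh⟩ : ∃ h, T.height = h + 1 := ⟨T.height - 1, by omega⟩
    have h1 := sqrt_PsiM_le_unroll us hc T T.height
    rw [levelM_eq_zero_of_height_le us (wPM us c) T T.height le_rfl, Real.sqrt_zero, mul_zero,
      add_zero, hh, sum_range_succ'] at h1
    simp only [pow_zero, one_mul, levelM_wSM_zero] at h1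
    have h2 := tail_le_phiM us hc T h
    rw [phiM, add_mul, one_mul, add_comm]
    linarith

/-- [folklore] `|s_T| ≤ Σ |x_k|` for the exact value of a summation tree. -/
private theorem abs_exactVal_le_absInputs (T : STree) : |T.exactVal| ≤ T.absInputs := by
  simpa using CompTree.abs_exact_le_absInputs (T.inst fun _ => 0)

/-- **Lemma 5 in mixed precision**: `Σ_k u_k² s_k² ≤ h̃ (Σ_k |x_k|)²` (each input `x_i` lies below
additions of total squared precision at most `h̃`). [cite: HallmanIpsen2023, §5, Theorem 27,
second line (via §2, Lemma 5)] -/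
theorem sumSqM_le_wHeight_mul_sq : ∀ T : STree, sumSqM us T ≤ wHeight us T * T.absInputs ^ 2
  | leaf _ => by simp [sumSqM, wHeight]
  | node k l r => by
      have ihl := sumSqM_le_wHeight_mul_sq l
      have ihr := sumSqM_le_wHeight_mul_sq r
      simp only [sumSqM, wHeight, absInputs]
      have hAl := absInputs_nonneg l
      have hAr := absInputs_nonneg r
      have hWl := wHeight_nonneg us l
      have hWr := wHeight_nonneg us r
      have hs : (exactVal l + exactVal r) ^ 2 ≤ (l.absInputs + r.absInputs) ^ 2 := by
        have h1 := (abs_add_le _ _).trans (add_le_add (abs_exactVal_le_absInputs l)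
          (abs_exactVal_le_absInputs r))
        exact sq_le_sq' (by linarith [neg_abs_le (exactVal l + exactVal r)])
          ((le_abs_self _).trans h1)
      set Wm := max (wHeight us l) (wHeight us r) with hWm
      have hl' : sumSqM us l ≤ Wm * l.absInputs ^ 2 :=
        ihl.trans (mul_le_mul_of_nonneg_right (le_max_left _ _) (sq_nonneg _))
      have hr' : sumSqM us r ≤ Wm * r.absInputs ^ 2 :=
        ihr.trans (mul_le_mul_of_nonneg_right (le_max_right _ _) (sq_nonneg _))
      have hWm0 : 0 ≤ Wm := hWl.trans (le_max_left _ _)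
      have hu : 0 ≤ us k ^ 2 := sq_nonneg _
      nlinarith [mul_le_mul_of_nonneg_left hs hu, mul_nonneg hWm0 (mul_nonneg hAl hAr)]

end ClosedFormM

/-! ### THEOREM 27 and COROLLARY 28: the closed-form bounds in mixed precision -/

section ClosedFormProbM

variable {Ω : Type*} [MeasurableSpace Ω] {μ : Measure Ω} {us : ℕ → ℝ} {δ : ℕ → Ω → ℝ}
  [IsProbabilityMeasure μ]

omit [IsProbabilityMeasure μ] in
/-- From a Theorem-26-type bound with F-parameter `λ' ≥ 0` to the two closed-form bounds with
`φ = λ' √(2h̃) exp(λ'² h̃)` (the deterministic steps of the proof of Theorem 27 and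
`(Σ u_k² s_k²)^{1/2} ≤ √h̃ Σ|x_k|`). [cite: HallmanIpsen2023, §5, Theorem 27 (t_52), proof] -/
theorem errBoundM_closedForm_of_recursive (T : STree) {lam' p : ℝ} (hl : 0 ≤ lam') {B : ℝ≥0∞}
    (hB : μ {ω | Real.sqrt (2 * Real.log (2 / p)) * Real.sqrt (PsiM lam' us T)
        < |(T.inst fun j => δ j ω).err|} ≤ B) :
    μ {ω | Real.sqrt (2 * Real.log (2 / p)) * (1 + phiM lam' (wHeight us T))
        * Real.sqrt (sumSqM us T) < |(T.inst fun j => δ j ω).err|} ≤ B ∧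
    μ {ω | Real.sqrt (wHeight us T) * Real.sqrt (2 * Real.log (2 / p))
        * (1 + phiM lam' (wHeight us T)) * T.absInputs < |(T.inst fun j => δ j ω).err|} ≤ B := by
  have hphi : 0 ≤ phiM lam' (wHeight us T) := phiM_nonneg hl _
  have h1 : Real.sqrt (2 * Real.log (2 / p)) * Real.sqrt (PsiM lam' us T)
      ≤ Real.sqrt (2 * Real.log (2 / p)) * (1 + phiM lam' (wHeight us T))
        * Real.sqrt (sumSqM us T) := by
    rw [mul_assoc]
    exact mul_le_mul_of_nonneg_left (sqrt_PsiM_le_closedForm us hl T) (Real.sqrt_nonneg _)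
  have h2 : Real.sqrt (2 * Real.log (2 / p)) * (1 + phiM lam' (wHeight us T))
        * Real.sqrt (sumSqM us T)
      ≤ Real.sqrt (wHeight us T) * Real.sqrt (2 * Real.log (2 / p))
        * (1 + phiM lam' (wHeight us T)) * T.absInputs := by
    have hss : Real.sqrt (sumSqM us T) ≤ Real.sqrt (wHeight us T) * T.absInputs := by
      have := Real.sqrt_le_sqrt (sumSqM_le_wHeight_mul_sq us T)
      rwa [Real.sqrt_mul (wHeight_nonneg us T), Real.sqrt_sq (absInputs_nonneg T)] at this
    calc Real.sqrt (2 * Real.log (2 / p)) * (1 + phiM lam' (wHeight us T))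
          * Real.sqrt (sumSqM us T)
        ≤ Real.sqrt (2 * Real.log (2 / p)) * (1 + phiM lam' (wHeight us T))
          * (Real.sqrt (wHeight us T) * T.absInputs) :=
          mul_le_mul_of_nonneg_left hss (by positivity)
      _ = _ := by ring
  constructor
  · refine (measure_mono (fun ω hω => ?_)).trans hB
    simp only [Set.mem_setOf_eq] at hω ⊢
    exact lt_of_le_of_lt h1 hω
  · refine (measure_mono (fun ω hω => ?_)).trans hB
    simp only [Set.mem_setOf_eq] at hω ⊢
    exact lt_of_le_of_lt (h1.trans h2) hω

/-- **Theorem 27 with `λ_{ñ,η}`** (the §2.2 Theorem 15 form): under the mixed-precision model, with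
probability at least `1 − (p + η)`,
`|e_n| ≤ √(2 ln(2/p)) (1 + φ_{ñ,h̃,η}) (Σ_k u_k² s_k²)^{1/2}`
`     ≤ √h̃ √(2 ln(2/p)) (1 + φ_{ñ,h̃,η}) Σ_k |x_k|`,
`φ_{ñ,h̃,η} = λ_{ñ,η} √(2h̃) exp(λ²_{ñ,η} h̃)`.
[cite: HallmanIpsen2023, §5, Theorem 27 (t_52) with §2.2, Theorem 15's `λ_{ñ,η}`] -/
theorem errBoundM_closedForm_ntilde (h : MPErrorModel μ us δ) {T : STree} (hT : T.WellLabeled)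
    {η p : ℝ} (hη : 0 < η) (hp : 0 < p) :
    μ {ω | Real.sqrt (2 * Real.log (2 / p)) * (1 + phiM (lam T.ntilde η) (wHeight us T))
        * Real.sqrt (sumSqM us T) < |(T.inst fun j => δ j ω).err|} ≤ ENNReal.ofReal (p + η) ∧
    μ {ω | Real.sqrt (wHeight us T) * Real.sqrt (2 * Real.log (2 / p))
        * (1 + phiM (lam T.ntilde η) (wHeight us T)) * T.absInputs
        < |(T.inst fun j => δ j ω).err|} ≤ ENNReal.ofReal (p + η) :=
  errBoundM_closedForm_of_recursive T (lam_nonneg _ _) (errBoundM_recursive_ntilde h hT hη hp)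

/-- **THEOREM 27 (Hallman–Ipsen): closed-form probabilistic error bound for summation in mixed
precision.** Under the mixed-precision model, for a well-labelled summation tree with `n` inputs and
weighted height `h̃ = max_k Σ_{k≺ℓ⪯n} u_ℓ²`, and `0 < η`, `0 < p` (HI's `δ`): with probability at
least `1 − (p + η)`,
`|e_n| ≤ √(2 ln(2/p)) (1 + φ_{n,h̃,η}) (Σ_{k=2}^n u_k² s_k²)^{1/2}`
`     ≤ √h̃ √(2 ln(2/p)) (1 + φ_{n,h̃,η}) Σ_{k=1}^n |x_k|`,
`φ_{n,h̃,η} = λ_{n,η} √(2h̃) exp(λ²_{n,η} h̃)`, `λ_{n,η} = √(2 ln(2n/η))` (both lines as tail bounds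
`μ {bound < |e_n|} ≤ p + η`; on the printed `φ` see the module docstring).
[cite: HallmanIpsen2023, §5, Theorem 27 (t_52, Thm. 27 of the arXiv text), eq. (def_phi2)] -/
theorem errBoundM_closedForm (h : MPErrorModel μ us δ) {T : STree} (hT : T.WellLabeled)
    {η p : ℝ} (hη : 0 < η) (hp : 0 < p) :
    μ {ω | Real.sqrt (2 * Real.log (2 / p)) * (1 + phiM (lam T.numInputs η) (wHeight us T))
        * Real.sqrt (sumSqM us T) < |(T.inst fun j => δ j ω).err|} ≤ ENNReal.ofReal (p + η) ∧
    μ {ω | Real.sqrt (wHeight us T) * Real.sqrt (2 * Real.log (2 / p))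
        * (1 + phiM (lam T.numInputs η) (wHeight us T)) * T.absInputs
        < |(T.inst fun j => δ j ω).err|} ≤ ENNReal.ofReal (p + η) :=
  errBoundM_closedForm_of_recursive T (lam_nonneg _ _) (errBoundM_recursive h hT hη hp)

/-- **COROLLARY 28 (Hallman–Ipsen): probabilistic error bound for mixed-precision FABsum.** Under
the mixed-precision model, if the computational tree of the blocked summation (blocks summed in
precision `u_lo` by trees of height at most `h_lo`, the block sums summed in precision `u_hi` by a
tree of height `h_hi`) has weighted height at most `h̃ = h_lo u_lo² + h_hi u_hi²` — the hypothesis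
`hh` — then with probability at least `1 − (p + η)`,
`|e_n| ≤ √h̃ √(2 ln(2/p)) (1 + φ_{n,h̃,η}) Σ_{k=1}^n |x_k|`.
[cite: HallmanIpsen2023, §5, Corollary 28 (c_fabsum, Cor. 28 of the arXiv text) and
Algorithm (alg:fabsum) "Mixed-precision FABsum"] -/
theorem errBoundM_fabsum (h : MPErrorModel μ us δ) {T : STree} (hT : T.WellLabeled)
    {η p : ℝ} (hη : 0 < η) (hp : 0 < p) {hlo hhi : ℕ} {ulo uhi : ℝ}
    (hh : wHeight us T ≤ hlo * ulo ^ 2 + hhi * uhi ^ 2) :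
    μ {ω | Real.sqrt (hlo * ulo ^ 2 + hhi * uhi ^ 2) * Real.sqrt (2 * Real.log (2 / p))
        * (1 + phiM (lam T.numInputs η) (hlo * ulo ^ 2 + hhi * uhi ^ 2)) * T.absInputs
        < |(T.inst fun j => δ j ω).err|} ≤ ENNReal.ofReal (p + η) := by
  refine (measure_mono ?_).trans (errBoundM_closedForm h hT hη hp).2
  intro ω hω
  simp only [Set.mem_setOf_eq] at hω ⊢
  refine lt_of_le_of_lt ?_ hω
  have hl : 0 ≤ lam T.numInputs η := lam_nonneg _ _
  have hW : 0 ≤ wHeight us T := wHeight_nonneg us T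
  have hphi := phiM_mono hl hh
  have hphi0 := phiM_nonneg hl (wHeight us T)
  have hA := absInputs_nonneg T
  gcongr

end ClosedFormProbM

end STree

end Literature.ComputerArithmetic.HallmanIpsen2023
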